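import Mathlib
import Literature.Combinatorics.Optimization.MaxKSatSosGap

/-!
# Schoenebeck 2008 for Max-`k`-XOR, all `k ≥ 3`: linear-degree sum-of-squares (and Sherali–Adams)
# does not beat `1/2`, and no small SDP relaxation does (LRS Thm 1.5 / 1.6) — PROVED

Schoenebeck (FOCS 2008; restated by Tulsiani, STOC 2009, §1: "a gap of factor 2 for MAX k-XOR for
`Ω(n)` [rounds of Lasserre]") proved that for every `k ≥ 3`, `Ω(n)` levels of the Lasserre /
sum-of-squares hierarchy believe a random `k`-XOR instance of constant density fully satisfiable,
while its true optimum is `≤ 1/2 + ε`.  The `k = 3` case, in the tree's Max-CSP currency, is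
`Grigoriev2001_maxThreeXorSos` / `Schoenebeck2008_maxThreeXorSA_holds`; this file proves the
statement for every `k ≥ 3`, on top of `MaxKSatSosGap.lean` (the `k`-clause bookkeeping
`litK`/`varK`/`scopeK`, the expansion count) and `GrigorievSchoenebeckPseudoDensity.lean` (the
Grigoriev–Schoenebeck pseudo-density and its XOR pairing `cubeExpect_gsDensity_mul_xorSatInd`):

* `xorK k` — the `k`-ary parity predicate (`xorK 3 = xorThree`, by `decide`); Max-`k`-XOR =
  Max-`literalClosure (xorK k)`; the XOR constraint of a `k`-clause `C` ("an odd number of the `k`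
  literals of `C` are true", `xorConstraintK`) reads `χ_{scope C}(x) = clauseSign C` in `±1`
  coordinates (`xorConstraintK_sat_iff`);
* `card_filter_xorGoodK_le` — a fixed assignment satisfies at most half of the `2^k·C(n,k)`
  constraints (sign-flip involution on one literal, `two_mul_card_filter_signProd_le`);
* `exists_good_xorTupleK` — expanding tuples all of whose assignments have value `≤ 1/2 + ε`
  (`Δ = ⌈16/ε²⌉`; the two counts add up to `< |kClauses k n|^{Δn}`);
* `Schoenebeck2008_maxKXorSos` — **for every `k ≥ 3`, `ε > 0`: `c_ε > 0`, `n₀` with, for all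
  `n ≥ n₀`, a Max-`k`-XOR instance of optimum `≤ 1/2 + ε` admitting no degree-`⌊c_ε n⌋`
  sum-of-squares certificate of `c − ℑ` for any `c < 1`**; `Schoenebeck2008_maxKXorSA` — the
  Sherali–Adams form (KMR Thm 7.5's shape: degree-`⌊c_ε n⌋` SA does not `(1 − ε, 1/2 + ε)`-approximate
  Max-`k`-XOR), via the tree's bridge `SAAchieves.achievesApprox`;
* `LeeRaghavendraSteurer2015_maxKXor_poly` / `_quasipoly` — with the tree's PROVED LRS Thm 1.6 /
  corrected Thm 6.4 (`LeeRaghavendraSteurer2015_poly_of_linearSosGap`,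
  `LeeRaghavendraSteurer2015_quasipoly_of_linearSosGap` of `MaxKSatSosGap.lean`): no SDP relaxation
  of size `n^C` (resp. `n^{α log n/log log n}`) achieves a `(c,s)`-approximation of Max-`k`-XOR for
  `1/2 < s < c < 1` — unconditional, every `k ≥ 3`.

No definitions of facts (D-0026): every statement here is a theorem.

## References

* G. Schoenebeck, *Linear Level Lasserre Lower Bounds for Certain k-CSPs*, FOCS 2008, 593–602
  [Schoenebeck2008] (Thm: `Ω(n)`-round Lasserre gap `2 − ε` for Max-`k`-XOR, `k ≥ 3`).
* M. Tulsiani, *CSP gaps and reductions in the Lasserre hierarchy*, STOC 2009 [Tulsiani2009], §1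
  and Thm 4.2 (held text `paper:galaxy-pdf-8496938138076993900`, p. 2 and p. 14).
* N. Fleming, P. Kothari, T. Pitassi, Found. Trends TCS 14 (2019), §5.1 (the `k = 3` write-up)
  [FlemingKothariPitassi2019].
* P. Kothari, R. Meka, P. Raghavendra, STOC 2017, Thm 7.5 / Fact 3.4 [KothariMekaRaghavendra2017];
  J. R. Lee, P. Raghavendra, D. Steurer, STOC 2015, Thm 1.5 / 1.6 [LeeRaghavendraSteurer2015].
-/

noncomputable section

open Finset Filter
open Literature.Probability.RandomGraphs.LowDegree (walsh sgn)
open Literature.Computability.Complexity (Literal Clause kClauses clauseOf)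
open Literature.Computability.MetaComplexity (ParityVec indVec clauseScope clauseVec clauseSign
  litSign posSign litVec IsCoverExpander VecExpands clauseVec_eq_indVec vecExpands_of_isBoundaryExpander
  nodup_map_fst_of_mem_kClauses card_clauseScope_of_mem_kClauses card_kClauses clauseSign_mul_self
  litSign_mul_self indVec_eq_sum card_le_of_forall_not_isCoverExpander_linear map_snd_clauseOf
  clauseScope_clauseOf clauseOf_injOn mem_clauseScope)

namespace Literature.Combinatorics.Optimization

variable {k n m : ℕ}

/-! ### The `k`-ary parity predicate and the XOR constraint of a `k`-clause -/

/-- The `k`-ary parity predicate `y_0 ⊕ ⋯ ⊕ y_{k−1}` (an odd number of `true` coordinates);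
Max-`k`-XOR = CSP(`xor_k`) with literals, i.e. Max-`literalClosure (xorK k)`.
[cite: Schoenebeck2008, §2 (random `k`-XOR)] -/
def xorK (k : ℕ) : (Fin k → Bool) → Bool :=
  fun y => decide (Odd ((univ : Finset (Fin k)).filter fun j => y j = true).card)

/-- `xorK 3` is the tree's `xorThree`. [cite: KothariMekaRaghavendra2017, §1 (p. 3)] -/
theorem xorK_three : xorK 3 = xorThree := by
  funext y
  have h : ∀ y : Fin 3 → Bool, xorK 3 y = xorThree y := by decide
  exact h y

/-- The literal pattern of the XOR constraint of a clause: coordinate `j` is negated iff the `j`-th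
literal is positive, so that `y_j ⊕ pattern_j = true` iff the `j`-th literal is true.
[cite: Schoenebeck2008, §5 (from `k`-XOR to `k`-SAT: "an odd number of true literals")] -/
def xorPatternK (C : ↥(kClauses k n)) : Fin k → Bool := fun j => !(litK C j).2

/-- The Max-`k`-XOR constraint of a `k`-clause: an odd number of its `k` literals are true.
[cite: Schoenebeck2008, §2 and §5] -/
def xorConstraintK (C : ↥(kClauses k n)) : CSPConstraint k n (literalClosure (xorK k)) :=
  ⟨fun y => xorK k fun j => xor (y j) (xorPatternK C j), ⟨xorPatternK C, rfl⟩, idxK C⟩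

/-- `χ_{scopeK C}(x) = ∏_{j<k} (−1)^{x_{v_j}}`. [cite: Schoenebeck2008, §3 (Fourier characters of the scopes)] -/
theorem walsh_scopeK (C : ↥(kClauses k n)) (x : Fin n → Bool) :
    walsh (scopeK C) x = ∏ j : Fin k, sgn (x (varK C j)) := by
  rw [walsh, scopeK, Finset.prod_image fun j₁ _ j₂ _ h => varK_injective C h]

/-- `clauseSign C = −∏_{j<k} litSign (litK C j)`. [cite: Schoenebeck2008, §5] -/
theorem clauseSign_eq_neg_prod_litK (C : ↥(kClauses k n)) :
    clauseSign C.1 = -∏ j : Fin k, litSign (litK C j) := by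
  have hlen := length_of_mem_kClauses C.2
  rw [clauseSign, posSign]
  congr 1
  exact Fintype.prod_equiv (finCongr hlen) _ _ fun j => rfl

/-- `∏_j (−1)^{x_{v_j}} = (∏_j litSign_j) · (−1)^{#true literals}`. [cite: Schoenebeck2008, §5] -/
theorem prod_sgn_varK_eq (C : ↥(kClauses k n)) (x : Fin n → Bool) :
    ∏ j : Fin k, sgn (x (varK C j)) = (∏ j : Fin k, litSign (litK C j)) *
      (-1) ^ ((univ : Finset (Fin k)).filter fun j => x (varK C j) = (litK C j).2).card := by
  have hj : ∀ j : Fin k, sgn (x (varK C j)) =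
      litSign (litK C j) * (if x (varK C j) = (litK C j).2 then -1 else 1) := by
    intro j
    unfold litSign
    cases x (varK C j) <;> cases (litK C j).2 <;> simp [sgn]
  rw [Finset.prod_congr rfl (fun j _ => hj j), Finset.prod_mul_distrib, Finset.prod_ite,
    Finset.prod_const, Finset.prod_const_one, mul_one]

/-- **The XOR constraint in `±1` coordinates:** `(xorConstraintK C).sat x ↔ χ_{scope C}(x) = clauseSign C`.
[cite: Schoenebeck2008, §5 ("`x_C = −∏ s_j`": an odd number of true literals)] -/
theorem xorConstraintK_sat_iff (C : ↥(kClauses k n)) (x : Fin n → Bool) :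
    (xorConstraintK C).sat x = true ↔ walsh (scopeK C) x = clauseSign C.1 := by
  classical
  set t := ((univ : Finset (Fin k)).filter fun j => x (varK C j) = (litK C j).2).card with ht
  have hfilter : ((univ : Finset (Fin k)).filter fun j => (xor (x (varK C j)) (xorPatternK C j)) = true) =
      (univ : Finset (Fin k)).filter fun j => x (varK C j) = (litK C j).2 := by
    refine Finset.filter_congr fun j _ => ?_
    unfold xorPatternK
    cases x (varK C j) <;> cases (litK C j).2 <;> simp
  have hsat : (xorConstraintK C).sat x = decide (Odd t) := by
    show xorK k (fun j => xor (x (varK C j)) (xorPatternK C j)) = _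
    simp only [xorK, hfilter, ht]
  rw [hsat, decide_eq_true_eq, walsh_scopeK, prod_sgn_varK_eq, clauseSign_eq_neg_prod_litK]
  set L := ∏ j : Fin k, litSign (litK C j) with hL
  have hL1 : L * L = 1 := by
    rw [hL, ← Finset.prod_mul_distrib]
    exact Finset.prod_eq_one fun j _ => litSign_mul_self _
  have hL0 : L ≠ 0 := fun h => by rw [h, mul_zero] at hL1; exact zero_ne_one hL1
  constructor
  · intro hodd
    rw [hodd.neg_one_pow]; ring
  · intro h
    by_contra hev
    rw [Nat.not_odd_iff_even] at hev
    rw [hev.neg_one_pow, mul_one] at h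
    exact hL0 (by linarith)

/-- **The Max-`k`-XOR instance of a clause tuple** `ω : Fin m → kClauses k n` (`m ≥ 1`).
[cite: Schoenebeck2008, §2 (random `k`-XOR with `Δ n` constraints)] -/
def xorInstanceK (ω : Fin m → ↥(kClauses k n)) (hm : 0 < m) :
    CSPInstance k n (literalClosure (xorK k)) :=
  ⟨m, hm, fun i => xorConstraintK (ω i)⟩

/-- The value of the Max-`k`-XOR instance at `x` as a count. [cite: Schoenebeck2008, §2] -/
theorem xorInstanceK_val (ω : Fin m → ↥(kClauses k n)) (hm : 0 < m) (x : Fin n → Bool) :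
    (xorInstanceK ω hm).val x =
      ((univ.filter fun i : Fin m => walsh (scopeK (ω i)) x = clauseSign (ω i).1).card : ℝ) / m := by
  unfold CSPInstance.val xorInstanceK
  simp only
  congr 1
  rw [← Finset.sum_boole]
  refine Finset.sum_congr rfl fun i _ => ?_
  by_cases h : walsh (scopeK (ω i)) x = clauseSign (ω i).1
  · rw [if_pos ((xorConstraintK_sat_iff (ω i) x).2 h), if_pos h]
  · have : ¬ (xorConstraintK (ω i)).sat x = true := fun h' => h ((xorConstraintK_sat_iff (ω i) x).1 h')
    rw [if_neg this, if_neg h]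

/-! ### The marginal: a fixed assignment satisfies at most half of the `k`-XOR constraints -/

/-- Extension of a sign pattern on `Fin k` to all naturals (by `false`), as in `kClauses`.
[cite: Schoenebeck2008, §2] -/
def extK (e : Fin k → Bool) : ℕ → Bool := fun i => if h : i < k then e ⟨i, h⟩ else false

/-- The parametrisation of `kClauses k n` by (scope, sign pattern). [cite: Schoenebeck2008, §2] -/
theorem kClauses_eq_image_extK :
    kClauses k n = (((univ : Finset (Fin n)).powersetCard k) ×ˢ (univ : Finset (Fin k → Bool))).image
      fun q => clauseOf q.1 (extK q.2) := rfl

/-- `clauseOf S (extK e)` is a `k`-clause for `|S| = k`. [cite: Schoenebeck2008, §2] -/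
theorem clauseOf_extK_mem {S : Finset (Fin n)} (hS : S.card = k) (e : Fin k → Bool) :
    clauseOf S (extK e) ∈ kClauses k n := by
  rw [kClauses_eq_image_extK, Finset.mem_image]
  exact ⟨(S, e), Finset.mem_product.2
    ⟨Finset.mem_powersetCard.2 ⟨Finset.subset_univ _, hS⟩, Finset.mem_univ _⟩, rfl⟩

/-- The `j`-th literal of `clauseOf S ε` has polarity `ε j`. [cite: Schoenebeck2008, §2] -/
theorem litK_clauseOf_snd {S : Finset (Fin n)} (ε : ℕ → Bool) (h : clauseOf S ε ∈ kClauses k n)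
    (j : Fin k) : (litK ⟨clauseOf S ε, h⟩ j).2 = ε j.1 := by
  have hlen : (clauseOf S ε).length = k := length_of_mem_kClauses h
  have hSk : S.card = k := by
    have := congrArg List.length (map_snd_clauseOf S ε)
    simp only [List.length_map, List.length_range, hlen] at this
    exact this.symm
  have e : ((clauseOf S ε).map Prod.snd)[j.1]'(by simp [hlen]) = (litK ⟨clauseOf S ε, h⟩ j).2 :=
    List.getElem_map ..
  rw [← e]
  simp only [map_snd_clauseOf, List.getElem_map, List.getElem_range]

/-- The scope of `clauseOf S ε` (as a subset of `Fin n`) is `S`. [cite: Schoenebeck2008, §2] -/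
theorem scopeK_clauseOf {S : Finset (Fin n)} (ε : ℕ → Bool) (h : clauseOf S ε ∈ kClauses k n) :
    scopeK ⟨clauseOf S ε, h⟩ = S := by
  have hmap : (scopeK ⟨clauseOf S ε, h⟩).map Fin.valEmbedding = S.map Fin.valEmbedding := by
    rw [← clauseScope_clauseOf S ε]
    ext v
    simp only [Finset.mem_map, Fin.valEmbedding_apply, scopeK, Finset.mem_image, Finset.mem_univ,
      true_and, mem_clauseScope]
    constructor
    · rintro ⟨i, ⟨j, rfl⟩, rfl⟩
      exact ⟨(litK ⟨clauseOf S ε, h⟩ j).2, by simpa [varK] using litK_mem ⟨clauseOf S ε, h⟩ j⟩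
    · rintro ⟨b, hb⟩
      obtain ⟨j, hj⟩ := exists_eq_litK ⟨clauseOf S ε, h⟩ hb
      exact ⟨varK ⟨clauseOf S ε, h⟩ j, ⟨j, rfl⟩, by simp [varK, hj]⟩
  exact Finset.map_injective _ hmap

/-- The `±1` product of a sign pattern. [folklore] -/
private def signProd (e : Fin k → Bool) : ℝ := ∏ j : Fin k, (if e j then (1 : ℝ) else -1)

/-- `clauseSign (clauseOf S (extK e)) = −signProd e`. [cite: Schoenebeck2008, §5] -/
private theorem clauseSign_clauseOf_extK {S : Finset (Fin n)} (e : Fin k → Bool)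
    (h : clauseOf S (extK e) ∈ kClauses k n) :
    clauseSign (clauseOf S (extK e)) = -signProd e := by
  have h1 := clauseSign_eq_neg_prod_litK ⟨clauseOf S (extK e), h⟩
  rw [h1, signProd]
  congr 1
  refine Finset.prod_congr rfl fun j _ => ?_
  rw [litSign, litK_clauseOf_snd _ h j, extK, dif_pos j.2]

/-- Flipping the first coordinate negates the sign product. [folklore] -/
private theorem signProd_update (hk : 1 ≤ k) (e : Fin k → Bool) :
    signProd (Function.update e ⟨0, hk⟩ (!e ⟨0, hk⟩)) = -signProd e := by
  unfold signProd
  rw [← Finset.mul_prod_erase univ _ (Finset.mem_univ (⟨0, hk⟩ : Fin k)),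
    ← Finset.mul_prod_erase univ (fun j => if e j then (1 : ℝ) else -1) (Finset.mem_univ (⟨0, hk⟩ : Fin k))]
  have hrest : ∏ j ∈ univ.erase (⟨0, hk⟩ : Fin k),
      (if Function.update e ⟨0, hk⟩ (!e ⟨0, hk⟩) j then (1 : ℝ) else -1) =
      ∏ j ∈ univ.erase (⟨0, hk⟩ : Fin k), (if e j then (1 : ℝ) else -1) := by
    refine Finset.prod_congr rfl fun j hj => ?_
    rw [Function.update_of_ne (Finset.ne_of_mem_erase hj)]
  rw [hrest, Function.update_self]
  cases e ⟨0, hk⟩ <;> simp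

/-- **Sign-flip involution:** for `c ≠ 0`, at most half of the `2^k` sign patterns have sign
product `c`. [folklore] -/
private theorem two_mul_card_filter_signProd_le (hk : 1 ≤ k) {c : ℝ} (hc : c ≠ 0) :
    2 * ((univ : Finset (Fin k → Bool)).filter fun e => signProd e = c).card ≤ 2 ^ k := by
  classical
  set A := (univ : Finset (Fin k → Bool)).filter fun e => signProd e = c with hA
  set B := (univ : Finset (Fin k → Bool)).filter fun e => signProd e = -c with hB
  set φ : (Fin k → Bool) → (Fin k → Bool) := fun e => Function.update e ⟨0, hk⟩ (!e ⟨0, hk⟩) with hφ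
  have hφφ : ∀ e, φ (φ e) = e := by
    intro e
    funext j
    by_cases hj : j = ⟨0, hk⟩
    · subst hj; simp [hφ]
    · simp [hφ, Function.update_of_ne hj]
  have hAB : A.card ≤ B.card := by
    refine Finset.card_le_card_of_injOn φ (fun e he => ?_) (fun e₁ _ e₂ _ h => ?_)
    · rw [Finset.mem_coe, hA, Finset.mem_filter] at he
      rw [Finset.mem_coe, hB, Finset.mem_filter]
      exact ⟨Finset.mem_univ _, by rw [hφ]; simp only; rw [signProd_update hk, he.2]⟩
    · have := congrArg φ h
      rwa [hφφ, hφφ] at this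
  have hdisj : Disjoint A B := by
    rw [hA, hB, Finset.disjoint_filter]
    intro e _ h1 h2
    rw [h1] at h2
    exact hc (by linarith)
  have hunion : (A ∪ B).card ≤ 2 ^ k := by
    calc (A ∪ B).card ≤ (univ : Finset (Fin k → Bool)).card := Finset.card_le_univ _
      _ = 2 ^ k := by rw [Finset.card_univ, Fintype.card_fun, Fintype.card_bool, Fintype.card_fin]
  rw [Finset.card_union_of_disjoint hdisj] at hunion
  omega

/-- On a fixed scope `S` (`|S| = k ≥ 1`), at most `2^{k−1}` of the `2^k` sign patterns make the XOR
constraint true at `x`. [cite: Schoenebeck2008, §2 (a random constraint is satisfied with probability `1/2`)] -/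
theorem two_mul_card_filter_xorGoodK_scope_le (hk : 1 ≤ k) {S : Finset (Fin n)} (hS : S.card = k)
    (x : Fin n → Bool) :
    2 * ((univ : Finset (Fin k → Bool)).filter fun e => ∃ h : clauseOf S (extK e) ∈ kClauses k n,
      walsh (scopeK ⟨clauseOf S (extK e), h⟩) x = clauseSign (clauseOf S (extK e))).card ≤ 2 ^ k := by
  classical
  have hw : walsh S x = 1 ∨ walsh S x = -1 := mul_self_eq_one_iff.1 (walsh_mul_self S x)
  have hw0 : -walsh S x ≠ 0 := by rcases hw with h | h <;> rw [h] <;> norm_num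
  have hiff : ∀ e : Fin k → Bool, (∃ h : clauseOf S (extK e) ∈ kClauses k n,
      walsh (scopeK ⟨clauseOf S (extK e), h⟩) x = clauseSign (clauseOf S (extK e))) ↔
      signProd e = -walsh S x := by
    intro e
    have hmem := clauseOf_extK_mem hS e
    rw [exists_prop_of_true hmem, scopeK_clauseOf _ hmem, clauseSign_clauseOf_extK e hmem]
    constructor <;> intro h <;> linarith
  rw [Finset.filter_congr fun e _ => hiff e]
  exact two_mul_card_filter_signProd_le hk hw0

/-- **At most half of the `k`-clauses (`k ≥ 1`) make their XOR constraint true under a fixed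
assignment.** [cite: Schoenebeck2008, §2 (expected value `1/2`)] -/
theorem card_filter_xorGoodK_le (hk : 1 ≤ k) (x : Fin n → Bool) :
    (((univ : Finset ↥(kClauses k n)).filter fun C => walsh (scopeK C) x = clauseSign C.1).card : ℝ) ≤
      (1 / 2 : ℝ) * Fintype.card ↥(kClauses k n) := by
  classical
  set dom := ((univ : Finset (Fin n)).powersetCard k) ×ˢ (univ : Finset (Fin k → Bool)) with hdom
  set P : Clause ℕ → Prop := fun C => ∃ h : C ∈ kClauses k n,
    walsh (scopeK ⟨C, h⟩) x = clauseSign C with hP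
  have hinj : Set.InjOn (fun q : Finset (Fin n) × (Fin k → Bool) => clauseOf q.1 (extK q.2)) ↑dom :=
    clauseOf_injOn k n
  have h1 : ((univ : Finset ↥(kClauses k n)).filter fun C => walsh (scopeK C) x = clauseSign C.1).card ≤
      ((kClauses k n).filter P).card := by
    refine Finset.card_le_card_of_injOn (fun C => C.1) (fun C hC => ?_)
      (fun a _ b _ h => Subtype.ext h)
    simp only [Finset.coe_filter, Finset.mem_univ, true_and, Set.mem_setOf_eq] at hC ⊢
    exact ⟨C.2, C.2, hC⟩
  have h2 : ((kClauses k n).filter P).card =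
      (dom.filter fun q => P (clauseOf q.1 (extK q.2))).card := by
    have himg : (dom.filter fun q => P (clauseOf q.1 (extK q.2))).image
        (fun q : Finset (Fin n) × (Fin k → Bool) => clauseOf q.1 (extK q.2)) =
        (kClauses k n).filter P := by
      ext C
      have hK : C ∈ kClauses k n ↔ ∃ q ∈ dom, clauseOf q.1 (extK q.2) = C := by
        rw [kClauses_eq_image_extK, Finset.mem_image]
      simp only [Finset.mem_image, Finset.mem_filter, hK]
      constructor
      · rintro ⟨q, ⟨hq, hPq⟩, rfl⟩
        exact ⟨⟨q, hq, rfl⟩, hPq⟩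
      · rintro ⟨⟨q, hq, rfl⟩, hPq⟩
        exact ⟨q, ⟨hq, hPq⟩, rfl⟩
    rw [← himg, Finset.card_image_of_injOn (hinj.mono (Finset.coe_subset.2 (Finset.filter_subset _ _)))]
  have h4 : 2 * (dom.filter fun q => P (clauseOf q.1 (extK q.2))).card ≤ n.choose k * 2 ^ k := by
    rw [Finset.card_filter, hdom, Finset.sum_product, Finset.mul_sum]
    calc ∑ S ∈ (univ : Finset (Fin n)).powersetCard k, 2 * ∑ e ∈ (univ : Finset (Fin k → Bool)),
          (if P (clauseOf (S, e).1 (extK (S, e).2)) then 1 else 0)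
        = ∑ S ∈ (univ : Finset (Fin n)).powersetCard k,
            2 * ((univ : Finset (Fin k → Bool)).filter fun e => P (clauseOf S (extK e))).card := by
          refine Finset.sum_congr rfl fun S _ => ?_
          rw [Finset.card_filter]
      _ ≤ ∑ _S ∈ (univ : Finset (Fin n)).powersetCard k, 2 ^ k := by
          refine Finset.sum_le_sum fun S hS => ?_
          exact two_mul_card_filter_xorGoodK_scope_le hk (Finset.mem_powersetCard.1 hS).2 x
      _ = n.choose k * 2 ^ k := by
          rw [Finset.sum_const, Finset.card_powersetCard, Finset.card_univ, Fintype.card_fin,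
            smul_eq_mul]
  have hcard : Fintype.card ↥(kClauses k n) = n.choose k * 2 ^ k := by
    rw [Fintype.card_coe, card_kClauses]
  rw [hcard]
  have h5 : 2 * ((univ : Finset ↥(kClauses k n)).filter fun C =>
      walsh (scopeK C) x = clauseSign C.1).card ≤ n.choose k * 2 ^ k := by
    have := h1.trans h2.le; omega
  have h6 : (2 : ℝ) * (((univ : Finset ↥(kClauses k n)).filter fun C =>
      walsh (scopeK C) x = clauseSign C.1).card : ℝ) ≤ ((n.choose k * 2 ^ k : ℕ) : ℝ) := by
    exact_mod_cast h5
  linarith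

/-! ### Good `k`-XOR tuples exist (expansion and value, by counting) -/

/-- **Good XOR tuples exist.** For `k ≥ 3` and `0 < ε ≤ 1` there are `Δ ≥ 1`, `κ > 0` and `n₀`
such that for every `n ≥ n₀` some tuple `ω` of `Δ n` clauses from `kClauses k n` has
`(⌊κn⌋, (2k+1)/4)`-cover expanding scopes and every assignment satisfying at most `(1/2 + ε) Δn`
of its XOR constraints (`card_le_of_forall_not_isCoverExpander_linear`;
`card_filter_exists_manyGood_le` with `p = 1/2`, `Δ = ⌈16/ε²⌉`).
[cite: Schoenebeck2008, §2–3 (a random `k`-XOR instance of density `Δ` is expanding and has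
value `≤ 1/2 + ε` w.h.p.)] -/
theorem exists_good_xorTupleK (hk : 3 ≤ k) {ε : ℝ} (hε0 : 0 < ε) (hε1 : ε ≤ 1) :
    ∃ Δ : ℕ, 1 ≤ Δ ∧ ∃ κ : ℝ, 0 < κ ∧ ∃ n₀ : ℕ, ∀ n : ℕ, n₀ ≤ n →
      ∃ ω : Fin (Δ * n) → ↥(kClauses k n),
        IsCoverExpander (fun i => clauseScope (ω i).1) (⌊κ * n⌋₊ : ℕ) ((2 * k + 1) / 4) ∧
        (∀ x : Fin n → Bool, ((univ.filter fun i : Fin (Δ * n) =>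
            walsh (scopeK (ω i)) x = clauseSign (ω i).1).card : ℝ) ≤ (1 / 2 + ε) * (Δ * n : ℕ)) := by
  classical
  -- constants
  set Δ : ℕ := ⌈16 / ε ^ 2⌉₊ with hΔdef
  have hΔ16 : 16 / ε ^ 2 ≤ (Δ : ℝ) := Nat.le_ceil _
  have hε2 : 0 < ε ^ 2 := by positivity
  have hΔ1 : 1 ≤ Δ := by
    have : (16 : ℝ) ≤ 16 / ε ^ 2 := by
      rw [le_div_iff₀ hε2]; nlinarith
    have h : (1 : ℝ) ≤ Δ := by linarith
    exact_mod_cast h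
  set a : ℝ := (2 * k + 1) / 4 with ha
  have hapos : 0 < a := by rw [ha]; positivity
  set B : ℝ := Real.exp (1 + a) * Δ * a with hB
  have hBpos : 0 < B := by rw [hB]; positivity
  set κ : ℝ := 1 / (a * (2 * B) ^ 4) with hκ
  have hκpos : 0 < κ := by rw [hκ]; positivity
  refine ⟨Δ, hΔ1, κ, hκpos, max k ⌈128 * a * B ^ 4⌉₊, fun n hn => ?_⟩
  have hkn : k ≤ n := le_of_max_le_left hn
  have hk1 : 1 ≤ k := by omega
  have hn1 : 1 ≤ n := by omega
  have hnr : (0 : ℝ) < n := by exact_mod_cast hn1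
  have hnB : 128 * a * B ^ 4 ≤ n := (Nat.le_ceil _).trans (by exact_mod_cast le_of_max_le_right hn)
  -- the clause space
  have hKc : (kClauses k n).card = n.choose k * 2 ^ k := card_kClauses k n
  have hK : (kClauses k n).Nonempty := by
    rw [← Finset.card_pos, hKc]
    exact Nat.mul_pos (Nat.choose_pos hkn) (by positivity)
  set X := ↥(kClauses k n)
  set m := Δ * n with hm
  have hcardX : (Fintype.card X : ℝ) = (kClauses k n).card := by rw [Fintype.card_coe]
  set T : ℝ := ((kClauses k n).card : ℝ) ^ m with hT
  have hTpos : 0 < T := by rw [hT]; exact pow_pos (by exact_mod_cast Finset.card_pos.2 hK) _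
  -- the two bad sets
  set badExp : Finset (Fin m → X) := univ.filter fun ω =>
    ¬ IsCoverExpander (fun i => clauseScope (ω i).1) (⌊κ * n⌋₊ : ℕ) ((2 * k + 1) / 4) with hbadExp
  set badXor : Finset (Fin m → X) := univ.filter fun ω => ∃ σ : Fin n → Bool,
    (1 / 2 + ε) * m < ((univ.filter fun i => walsh (scopeK (ω i)) σ = clauseSign (ω i).1).card : ℝ)
    with hbadXor
  -- (1) expansion failures
  have h1 : (badExp.card : ℝ) ≤ T / 4 := by
    have hN : a * (⌊κ * n⌋₊ : ℕ) ≤ n / (2 * B) ^ 4 := by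
      have hf : ((⌊κ * n⌋₊ : ℕ) : ℝ) ≤ κ * n := Nat.floor_le (by positivity)
      have : a * (κ * n) = n / (2 * B) ^ 4 := by
        rw [hκ]; field_simp
      calc a * (⌊κ * n⌋₊ : ℕ) ≤ a * (κ * n) := by gcongr
        _ = n / (2 * B) ^ 4 := this
    have h := card_le_of_forall_not_isCoverExpander_linear (k := k) (Δ := Δ) (n := n)
      (N := ⌊κ * n⌋₊) (a := a) (B := B) hk hΔ1 hn1 hK ha hB hN badExp
      (fun c hc => (Finset.mem_filter.1 hc).2)
    have hcoef : 32 * a * B ^ 4 / n ≤ 1 / 4 := by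
      rw [div_le_iff₀ hnr]
      calc (32 : ℝ) * a * B ^ 4 = 1 / 4 * (128 * a * B ^ 4) := by ring
        _ ≤ 1 / 4 * (n : ℝ) := by gcongr
    calc (badExp.card : ℝ) ≤ 32 * a * B ^ 4 / n * ((((kClauses k n).card ^ (Δ * n) : ℕ)) : ℝ) := h
      _ ≤ 1 / 4 * T := by
          rw [hT, hm]; push_cast
          exact mul_le_mul_of_nonneg_right hcoef (by positivity)
      _ = T / 4 := by ring
  -- (2) value failures
  have h2 : (badXor.card : ℝ) ≤ 2 / 7 * T := by
    have h := card_filter_exists_manyGood_le (n := n) (X := X)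
      (fun σ C => walsh (scopeK C) σ = clauseSign C.1)
      (p := 1 / 2) (ε := ε) (by norm_num) (fun σ => card_filter_xorGoodK_le hk1 σ) hε0.le hε1 m
    rw [hcardX] at h
    have hq : (2 : ℝ) ≤ (1 - 1 / 2) * ε ^ 2 * Δ := by
      have : (16 : ℝ) ≤ ε ^ 2 * Δ := by
        calc (16 : ℝ) = ε ^ 2 * (16 / ε ^ 2) := by field_simp
          _ ≤ ε ^ 2 * Δ := by gcongr
      linarith
    have h2n := two_pow_mul_exp_neg_two_mul_le hn1
    have hexple : Real.exp (-((1 - 1 / 2) * ε ^ 2 * (m : ℕ))) ≤ Real.exp (-(2 * n)) := by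
      rw [Real.exp_le_exp, hm]; push_cast; nlinarith
    have h3 : (2 : ℝ) ^ n * Real.exp (-((1 - 1 / 2) * ε ^ 2 * (m : ℕ))) ≤ 2 / 7 :=
      le_trans (by gcongr) h2n
    calc (badXor.card : ℝ) ≤ 2 ^ n * (((kClauses k n).card : ℝ) ^ m *
          Real.exp (-((1 - 1 / 2) * ε ^ 2 * m))) := h
      _ = 2 ^ n * Real.exp (-((1 - 1 / 2) * ε ^ 2 * (m : ℕ))) * T := by rw [hT]; ring
      _ ≤ 2 / 7 * T := mul_le_mul_of_nonneg_right h3 hTpos.le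
  -- a tuple outside the two bad sets
  have hlt : ((badExp ∪ badXor).card : ℝ) < (univ : Finset (Fin m → X)).card := by
    have hU : ((univ : Finset (Fin m → X)).card : ℝ) = T := by
      rw [Finset.card_univ, Fintype.card_fun, Fintype.card_fin, hT, Nat.cast_pow, hcardX]
    have hu : ((badExp ∪ badXor).card : ℝ) ≤ badExp.card + badXor.card := by
      exact_mod_cast Finset.card_union_le badExp badXor
    rw [hU]
    linarith
  have hne : ((univ : Finset (Fin m → X)) \ (badExp ∪ badXor)).Nonempty := by
    rw [Finset.nonempty_iff_ne_empty]
    intro h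
    have := Finset.card_sdiff_add_card_eq_card (Finset.subset_univ (badExp ∪ badXor))
    rw [h, Finset.card_empty, zero_add] at this
    rw [this] at hlt
    exact lt_irrefl _ hlt
  obtain ⟨ω, hω⟩ := hne
  rw [Finset.mem_sdiff, Finset.mem_union, not_or] at hω
  obtain ⟨-, hωE, hωX⟩ := hω
  refine ⟨ω, ?_, fun x => ?_⟩
  · by_contra hc
    exact hωE (Finset.mem_filter.2 ⟨Finset.mem_univ _, hc⟩)
  · by_contra hc
    push Not at hc
    exact hωX (Finset.mem_filter.2 ⟨Finset.mem_univ _, x, hc⟩)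

/-! ### The pseudo-expectation of the value of the XOR instance -/

/-- For a `(N, (2k+1)/4)`-cover expanding tuple and `d ≤ N/4` (`N ≥ 2`, `d ≥ k`), the
Grigoriev–Schoenebeck pseudo-density of degree `d` with the parity signs `clauseSign` gives the
Max-`k`-XOR instance pseudo-expected value `1`. [cite: Schoenebeck2008, §3 (the vectors satisfy
every XOR constraint)] -/
theorem cubeExpect_gsDensity_mul_xorInstanceK_val (ω : Fin m → ↥(kClauses k n)) (hm : 0 < m)
    {N : ℝ} {d : ℕ} (hexp : IsCoverExpander (fun i => clauseScope (ω i).1) N ((2 * k + 1) / 4))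
    (hN : 2 ≤ N) (hd : (d : ℝ) ≤ 1 / 2 * N / 2) (hkd : k ≤ d) :
    cubeExpect (fun x => gsDensity n (tupleVecsK ω) (tupleSatSignsK ω) N d x *
      (xorInstanceK ω hm).val x) = 1 := by
  classical
  have hvec := vecExpands_tupleVecsK ω hexp
  have hc : (0 : ℝ) < 1 / 2 := by norm_num
  have hr0 : (0 : ℝ) ≤ N := by linarith
  have hb : ∀ i, tupleSatSignsK ω i * tupleSatSignsK ω i = 1 := fun i => clauseSign_mul_self _
  set D := gsDensity n (tupleVecsK ω) (tupleSatSignsK ω) N d with hD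
  have hval : ∀ x, (xorInstanceK ω hm).val x =
      (1 / (m : ℝ)) * ∑ i : Fin m, xorSatInd (scopeK (ω i)) (clauseSign (ω i).1) x := by
    intro x
    unfold CSPInstance.val xorInstanceK
    simp only
    have hterm : ∀ i : Fin m, (if (xorConstraintK (ω i)).sat x then (1 : ℝ) else 0) =
        xorSatInd (scopeK (ω i)) (clauseSign (ω i).1) x := by
      intro i
      rw [xorSatInd_eq_ite _ (mul_self_eq_one_iff.1 (clauseSign_mul_self (ω i).1))]
      by_cases h : walsh (scopeK (ω i)) x = clauseSign (ω i).1
      · rw [if_pos ((xorConstraintK_sat_iff (ω i) x).2 h), if_pos h]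
      · have : ¬ (xorConstraintK (ω i)).sat x = true :=
          fun h' => h ((xorConstraintK_sat_iff (ω i) x).1 h')
        rw [if_neg this, if_neg h]
    rw [Finset.sum_congr rfl fun i _ => hterm i]
    field_simp
  have hfun : (fun x => D x * (xorInstanceK ω hm).val x) =
      fun x => D x * ((1 / (m : ℝ)) * ∑ i : Fin m, xorSatInd (scopeK (ω i)) (clauseSign (ω i).1) x) := by
    funext x; rw [hval x]
  rw [hfun, cubeExpect_mul_const_mul, cubeExpect_mul_finset_sum]
  have hone : ∀ i ∈ (univ : Finset (Fin m)),
      cubeExpect (fun x => D x * xorSatInd (scopeK (ω i)) (clauseSign (ω i).1) x) = 1 := by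
    intro i _
    exact cubeExpect_gsDensity_mul_xorSatInd hvec hc hd hN hb i (scopeK (ω i))
      (toVec_scopeK (ω i)).symm (by rw [card_scopeK]; exact hkd)
  rw [Finset.sum_congr rfl hone, Finset.sum_const, Finset.card_univ, Fintype.card_fin,
    nsmul_eq_mul, mul_one]
  have hmr : (m : ℝ) ≠ 0 := by exact_mod_cast hm.ne'
  field_simp

/-! ### Schoenebeck's theorem for Max-`k`-XOR: sum of squares and Sherali–Adams -/

/-- **Schoenebeck 2008 (Max-`k`-XOR, `Ω(n)`-round Lasserre gap `2 − ε`), all `k ≥ 3` — PROVED.**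
For every `k ≥ 3` and `ε > 0` there are `c_ε > 0` and `n₀` such that for every `n ≥ n₀` some
Max-`k`-XOR instance `ℑ` on `n` variables has `opt ≤ 1/2 + ε` while no `c < 1` has a
degree-`⌊c_ε n⌋` sum-of-squares certificate of `c − ℑ` on `{0,1}ⁿ`.
[cite: Schoenebeck2008, §3 (main theorem for random `k`-XOR; restated in Tulsiani2009, §1 p. 2)] -/
theorem Schoenebeck2008_maxKXorSos (hk : 3 ≤ k) :
    ∀ ε : ℝ, 0 < ε → ∃ cε : ℝ, 0 < cε ∧ ∃ n₀ : ℕ, ∀ n : ℕ, n₀ ≤ n →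
      ∃ I : CSPInstance k n (literalClosure (xorK k)), I.OptLE (1 / 2 + ε) ∧
        ∀ c : ℝ, c < 1 → ¬ HasSosCertificate ⌊cε * n⌋₊ (fun x => c - I.val x) := by
  intro ε hε
  classical
  set ε' : ℝ := min ε 1 with hε'
  have hε'0 : 0 < ε' := lt_min hε one_pos
  have hε'1 : ε' ≤ 1 := min_le_right _ _
  have hε'ε : ε' ≤ ε := min_le_left _ _
  obtain ⟨Δ, hΔ, κ, hκ, n₀, H⟩ := exists_good_xorTupleK hk hε'0 hε'1
  refine ⟨κ / 32, by positivity, max n₀ ⌈(32 * k + 128) / κ⌉₊, fun n hn => ?_⟩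
  have hn₀ : n₀ ≤ n := le_of_max_le_left hn
  have hκn : 32 * k + 128 ≤ κ * n := by
    have h1 : (⌈(32 * k + 128) / κ⌉₊ : ℝ) ≤ n := by exact_mod_cast le_of_max_le_right hn
    have h2 : (32 * k + 128) / κ ≤ n := (Nat.le_ceil _).trans h1
    rw [div_le_iff₀ hκ] at h2
    linarith
  have hk0 : (0 : ℝ) ≤ k := by positivity
  obtain ⟨hN2, hd2, hdN⟩ := degree_bookkeeping hκ (by linarith)
  obtain ⟨ω, hexp, hxor⟩ := H n hn₀
  have hn1 : 1 ≤ n := by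
    by_contra h; push Not at h
    have : n = 0 := by omega
    rw [this] at hκn; simp at hκn; linarith
  have hm : 0 < Δ * n := Nat.mul_pos (by omega) (by omega)
  set d : ℕ := ⌊κ / 32 * n⌋₊ with hddef
  have hkd : k ≤ d := by
    refine Nat.le_floor ?_
    have : (k : ℝ) ≤ κ / 32 * n := by linarith
    exact this
  have hdle : (d : ℝ) ≤ 1 / 2 * ((⌊κ * n⌋₊ : ℕ) : ℝ) / 2 := by
    have : (d : ℝ) ≤ ((2 * d : ℕ) : ℝ) := by push_cast; linarith
    exact this.trans hdN
  refine ⟨xorInstanceK ω hm, fun x => ?_, fun c hc hsos => ?_⟩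
  · rw [xorInstanceK_val ω hm x, div_le_iff₀ (by exact_mod_cast hm)]
    calc _ ≤ (1 / 2 + ε') * (Δ * n : ℕ) := hxor x
      _ ≤ (1 / 2 + ε) * (Δ * n : ℕ) := by push_cast; gcongr
      _ = (1 / 2 + ε) * ((Δ * n : ℕ) : ℝ) := by push_cast; ring
  · have hvec := vecExpands_tupleVecsK ω hexp
    have hb : ∀ i, tupleSatSignsK ω i * tupleSatSignsK ω i = 1 := fun i => clauseSign_mul_self _
    have hD := isPseudoDensity_gsDensity (n := n) (b := tupleSatSignsK ω) hvec (by norm_num) hdle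
      (by linarith) hb
    have h0 := hD.cubeExpect_mul_nonneg hsos
    rw [cubeExpect_mul_sub, cubeExpect_mul_const, hD.1,
      cubeExpect_gsDensity_mul_xorInstanceK_val ω hm hexp hN2 hdle hkd] at h0
    linarith

/-- **Schoenebeck 2008 in Sherali–Adams currency (the shape of KMR Thm 7.5), all `k ≥ 3` —
PROVED.** For every `k ≥ 3` and `ε > 0` there are `c_ε > 0` and `n₀` such that for every `n ≥ n₀`
the degree-`⌊c_ε n⌋` Sherali–Adams relaxation fails to achieve a `(1 − ε, 1/2 + ε)`-approximation
of Max-`k`-XOR on `n` variables: the good tuple's instance has `opt ≤ 1/2 + ε`, the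
Grigoriev–Schoenebeck pseudo-density of degree `2d` gives it value `1`, so no degree-`2d`
certificate of `(1 − ε) − ℑ` exists, hence (`SAAchieves.achievesApprox`, KMR Fact 3.4) degree-`d`
Sherali–Adams has value `> 1 − ε` on it.
[cite: Schoenebeck2008, §3] [cite: KothariMekaRaghavendra2017, Thm 7.5 (p. 21) and Fact 3.4] -/
theorem Schoenebeck2008_maxKXorSA (hk : 3 ≤ k) :
    ∀ ε : ℝ, 0 < ε → ∃ cε : ℝ, 0 < cε ∧ ∃ n₀ : ℕ, ∀ n : ℕ, n₀ ≤ n →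
      ¬ SAAchieves (n := n) (literalClosure (xorK k)) ⌊cε * n⌋₊ (1 - ε) (1 / 2 + ε) := by
  intro ε hε
  classical
  set ε' : ℝ := min ε 1 with hε'
  have hε'0 : 0 < ε' := lt_min hε one_pos
  have hε'1 : ε' ≤ 1 := min_le_right _ _
  have hε'ε : ε' ≤ ε := min_le_left _ _
  obtain ⟨Δ, hΔ, κ, hκ, n₀, H⟩ := exists_good_xorTupleK hk hε'0 hε'1
  refine ⟨κ / 32, by positivity, max n₀ ⌈(32 * k + 128) / κ⌉₊, fun n hn hSA => ?_⟩
  have hn₀ : n₀ ≤ n := le_of_max_le_left hn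
  have hκn : 32 * k + 128 ≤ κ * n := by
    have h1 : (⌈(32 * k + 128) / κ⌉₊ : ℝ) ≤ n := by exact_mod_cast le_of_max_le_right hn
    have h2 : (32 * k + 128) / κ ≤ n := (Nat.le_ceil _).trans h1
    rw [div_le_iff₀ hκ] at h2
    linarith
  have hk0 : (0 : ℝ) ≤ k := by positivity
  obtain ⟨hN2, hd2, hdN⟩ := degree_bookkeeping hκ (by linarith)
  obtain ⟨ω, hexp, hxor⟩ := H n hn₀
  have hn1 : 1 ≤ n := by
    by_contra h; push Not at h
    have : n = 0 := by omega
    rw [this] at hκn; simp at hκn; linarith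
  have hm : 0 < Δ * n := Nat.mul_pos (by omega) (by omega)
  set d : ℕ := ⌊κ / 32 * n⌋₊ with hddef
  have hkd : k ≤ d := by
    refine Nat.le_floor ?_
    have : (k : ℝ) ≤ κ / 32 * n := by linarith
    exact this
  have hk2d : k ≤ 2 * d := by omega
  -- the instance and its soundness
  have hopt : (xorInstanceK ω hm).OptLE (1 / 2 + ε) := by
    intro x
    rw [xorInstanceK_val ω hm x, div_le_iff₀ (by exact_mod_cast hm)]
    calc _ ≤ (1 / 2 + ε') * (Δ * n : ℕ) := hxor x
      _ ≤ (1 / 2 + ε) * (Δ * n : ℕ) := by push_cast; gcongr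
      _ = (1 / 2 + ε) * ((Δ * n : ℕ) : ℝ) := by push_cast; ring
  -- Sherali–Adams ⇒ subspace sos of degree `d` ⇒ certificate of degree `2d`
  have hsub : SubspaceSos (degreeLE n ((2 * d) / 2)) (xorInstanceK ω hm).val (1 - ε) := by
    rw [Nat.mul_div_cancel_left d two_pos]
    exact hSA.achievesApprox (xorInstanceK ω hm) hopt
  rw [subspaceSos_degreeLE_iff] at hsub
  -- the pseudo-density of degree `2d`
  have hvec := vecExpands_tupleVecsK ω hexp
  have hb : ∀ i, tupleSatSignsK ω i * tupleSatSignsK ω i = 1 := fun i => clauseSign_mul_self _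
  have hD := isPseudoDensity_gsDensity (n := n) (b := tupleSatSignsK ω) (d := 2 * d) hvec
    (by norm_num) hdN (by linarith) hb
  have h0 := hD.cubeExpect_mul_nonneg hsub
  rw [cubeExpect_mul_sub, cubeExpect_mul_const, hD.1,
    cubeExpect_gsDensity_mul_xorInstanceK_val ω hm hexp hN2 hdN hk2d] at h0
  linarith

/-- **Schoenebeck's `k`-XOR theorem in `(c,s)`-approximation currency:** for `k ≥ 3`, `ε > 0`
there are `c_ε > 0`, `n₀` such that for `n ≥ n₀`, `d ≤ ⌊c_ε n⌋`, `c < 1`, the degree-`d`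
sum-of-squares relaxation fails to `(c, 1/2 + ε)`-approximate Max-`k`-XOR on `n` variables.
[cite: Schoenebeck2008, §3] -/
theorem Schoenebeck2008_maxKXorSos_not_achievesApprox (hk : 3 ≤ k) {ε : ℝ} (hε : 0 < ε) :
    ∃ cε : ℝ, 0 < cε ∧ ∃ n₀ : ℕ, ∀ n : ℕ, n₀ ≤ n → ∀ d : ℕ, d ≤ ⌊cε * n⌋₊ →
      ∀ c : ℝ, c < 1 →
        ¬ AchievesApprox (literalClosure (xorK k)) (degreeLE n (d / 2)) c (1 / 2 + ε) := by
  obtain ⟨cε, hcε, n₀, H⟩ := Schoenebeck2008_maxKXorSos hk ε hε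
  refine ⟨cε, hcε, n₀, fun n hn d hd c hc hA => ?_⟩
  obtain ⟨I, hI, hnot⟩ := H n hn
  have h1 : SubspaceSos (degreeLE n (d / 2)) I.val c := hA I hI
  rw [subspaceSos_degreeLE_iff] at h1
  exact hnot c hc (h1.of_degree_le hd)

/-! ### No small SDP relaxation beats `1/2` on Max-`k`-XOR (LRS Thm 1.6 and Thm 1.5) -/

/-- **Lee–Raghavendra–Steurer 2015 × Schoenebeck 2008: polynomial-size SDP relaxations of
Max-`k`-XOR cannot beat `1/2`, every `k ≥ 3` — PROVED.** For all `s > 1/2`, `c < 1`, `C ∈ ℕ` and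
all large `n`, no subspace `U` of functions on `{0,1}ⁿ` with `dim U ≤ n^C` achieves a
`(c,s)`-approximation of Max-`k`-XOR. [cite: LeeRaghavendraSteurer2015, Thm 1.6 (p. 6)] [cite: Schoenebeck2008, §3] -/
theorem LeeRaghavendraSteurer2015_maxKXor_poly (hk : 3 ≤ k) :
    ∀ s : ℝ, 1 / 2 < s → ∀ c : ℝ, c < 1 → ∀ C : ℕ, ∃ n₀ : ℕ, ∀ n : ℕ, n₀ ≤ n →
      ∀ U : Submodule ℝ ((Fin n → Bool) → ℝ), (Module.finrank ℝ U : ℝ) ≤ (n : ℝ) ^ C →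
        ¬ AchievesApprox (literalClosure (xorK k)) (U : Set ((Fin n → Bool) → ℝ)) c s :=
  LeeRaghavendraSteurer2015_poly_of_linearSosGap (literalClosure (xorK k))
    fun _ hε => Schoenebeck2008_maxKXorSos_not_achievesApprox hk hε

/-- **Lee–Raghavendra–Steurer 2015 Thm 1.5 for Max-`k`-XOR, every `k ≥ 3` — PROVED:** there is
`α > 0` such that for all `1/2 < s < c < 1` and all large `n`, no SDP relaxation of Max-`k`-XOR
of size `≤ n^{α log n / log log n}` achieves a `(c,s)`-approximation.
[cite: LeeRaghavendraSteurer2015, Thm 1.5 (p. 6) and its proof (p. 26–27)] [cite: Schoenebeck2008, §3] -/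
theorem LeeRaghavendraSteurer2015_maxKXor_quasipoly (hk : 3 ≤ k) :
    ∃ α : ℝ, 0 < α ∧ ∀ s : ℝ, 1 / 2 < s → ∀ c : ℝ, s < c → c < 1 →
      ∃ n₀ : ℕ, ∀ n : ℕ, n₀ ≤ n → ∀ U : Submodule ℝ ((Fin n → Bool) → ℝ),
        (Module.finrank ℝ U : ℝ) ≤ (n : ℝ) ^ (α * Real.log n / Real.log (Real.log n)) →
        ¬ AchievesApprox (literalClosure (xorK k)) (U : Set ((Fin n → Bool) → ℝ)) c s :=
  LeeRaghavendraSteurer2015_quasipoly_of_linearSosGap hk (literalClosure (xorK k))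
    (by norm_num : (0 : ℝ) ≤ 1 / 2)
    fun _ hε => Schoenebeck2008_maxKXorSos_not_achievesApprox hk hε

end Literature.Combinatorics.Optimization

end
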